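import Summits.Ventures.WeilGRH.ModulationCostOscillation
import Summits.RiemannHypothesis.RiemannHypothesis.Theorems.WeilFormatCEntryArchIntegrals
import Literature.Analysis.SpecialFunctions.DigammaStirlingSeries
import Mathlib.Analysis.Real.Pi.Bounds
import HarnessLib

/-!
# rh-explicit (venture WeilGRH): THE OSCILLATORY ARCHIMEDEAN INCREMENT TO SECOND ORDER —
  `|∫₀^∞ ρ(t) min(t,2a) cos(τt) dt| ≤ 0.75/τ² + 2.89/|τ|³ + E(a)/(¼ + τ²)` (weil-3 gen14)

Cell `rh-explicit`, WEIL TRACK (structure seat weil-3, gen14).  RH-free real analysis; no measure, no zeros.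

`ModulationCostOscillation` (gen11) bounds the oscillatory archimedean increment of the modulated window
`u_τ = e^{−iτx}χ_0` termwise in the exponential split `ρ = Σ_m e^{−l_m t}` (`l_m = 2m + ½`), getting `2/|τ| + 2/τ²`.
But the node integrals are EXACT, `∫₀^∞ e^{−lt} min(t,2a) cos(τt) dt = Re[(1 − e^{−2a(l+iτ)})/(l+iτ)²]`
(`integral_exp_neg_mul_min_mul_cos`), and their main parts SUM IN CLOSED FORM, with cancellation:
`Σ_m Re[1/(l_m+iτ)²] = Σ_m (l_m² − τ²)/(l_m² + τ²)² = ¼ Re ψ′(¼ + iτ/2)` (`hasSum_re_deriv_digamma_quarter`), which is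
`O(1/τ²)` by Stirling's series for `ψ′` (`DigammaStirlingSeries.norm_deriv_digamma_sub_stirlingSeries_le`:
`ψ′(w) = 1/w + 1/(2w²) + 1/(6w³) + O(|w|⁻³)`, with `Re(1/w) = ¼/|w|²` on the quarter line); the exponentially small
parts total `≤ E(a)/(¼ + τ²)`, `E(a) = Σ_m e^{−2al_m} = e^{−a}/(1 − e^{−4a})`:

* `abs_integral_weilArchDensity_mul_min_mul_cos_sub_sum_le` (exact finite split + the gen11 tail):
  `|∫ρ min cos − Σ_{m<M} Re[(1 − e^{−2a z_m})/z_m²]| ≤ 1/L² + 1/(2L)`, `z_m = l_m + iτ`, `L = 2M + ½`;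
* **`abs_integral_weilArchDensity_mul_min_mul_cos_le_trigamma`** (`a > 0`, every `τ`):
  `|∫₀^∞ ρ(t) min(t,2a) cos(τt) dt| ≤ |Re ψ′(¼+iτ/2)|/4 + E(a)/(¼ + τ²)`;
* `abs_re_deriv_digamma_quarter_le_second` (`|τ| ≥ 2`): `|Re ψ′(¼+iτ/2)| ≤ 3/τ² + 11.53/|τ|³`
  (the gen13 tree bound `YoshidaGramEntryBoundsPrelim.abs_re_deriv_digamma_quarter_le` is `8/|τ|`);
* **`abs_integral_weilArchDensity_mul_min_mul_cos_le_second`** (`a > 0`, `|τ| ≥ 2`):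
  `|∫₀^∞ ρ(t) min(t,2a) cos(τt) dt| ≤ 0.75/τ² + 2.89/|τ|³ + E(a)/(¼ + τ²)` — at the first-zero height `τ ≈ 14.4`
  of the frontier rung this is `0.007` against gen11's `0.148`;
* the second-order archimedean BUDGETS of the modulated window built on this are in `ArchBudgetSecondOrder.lean`.

Imports are built modules only.  No definitions, no named facts; RH-free.
-/

set_option autoImplicit false

noncomputable section

open Complex Filter Set MeasureTheory
open scoped Real Topology

namespace Summit.Ventures.WeilGRH

open Literature.NumberTheory.LFunctions
open Literature.Analysis.SpecialFunctions (digammaNode digammaNode_pos reDigammaQuarter)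
open Summit.RiemannHypothesis.RiemannHypothesis.Theorems.WeilFormatC (hasSum_re_deriv_digamma_quarter
  summable_exp_neg_two_mul_digammaNode)

variable {a : ℝ}

/-! ## The node terms -/

/-- `Re[1/(l + iτ)²] = (l² − τ²)/(l² + τ²)²`. -/
theorem re_one_div_sq_node (l τ : ℝ) :
    (1 / ((l : ℂ) + τ * I) ^ 2).re = (l ^ 2 - τ ^ 2) / (l ^ 2 + τ ^ 2) ^ 2 := by
  have hz : ((l : ℂ) + τ * I) ^ 2 = ⟨l ^ 2 - τ ^ 2, 2 * l * τ⟩ := by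
    apply Complex.ext
    · simp [sq, Complex.mul_re]
    · simp [sq, Complex.mul_im]; ring
  rw [hz, one_div, Complex.inv_re, Complex.normSq_mk]
  have e : (l ^ 2 - τ ^ 2) * (l ^ 2 - τ ^ 2) + 2 * l * τ * (2 * l * τ) = (l ^ 2 + τ ^ 2) ^ 2 := by ring
  rw [e]

/-- `‖e^{−2a(l+iτ)}/(l+iτ)²‖ = e^{−2al}/(l² + τ²)`. -/
theorem norm_cexp_neg_div_sq_node (l τ a : ℝ) :
    ‖cexp (-(((l : ℂ) + τ * I) * (2 * a : ℝ))) / ((l : ℂ) + τ * I) ^ 2‖ = Real.exp (-(2 * a * l)) / (l ^ 2 + τ ^ 2) := by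
  rw [norm_div, norm_pow, Complex.norm_exp]
  have hre : (-(((l : ℂ) + τ * I) * (2 * a : ℝ))).re = -(2 * a * l) := by
    simp [Complex.mul_re]; ring
  have hn : ‖(l : ℂ) + τ * I‖ ^ 2 = l ^ 2 + τ ^ 2 := by
    rw [Complex.sq_norm, Complex.normSq_apply]; simp; ring
  rw [hre, hn]

/-- The node term splits: `Re[(1 − e^{−2az})/z²] = Re[1/z²] − Re[e^{−2az}/z²]`. -/
theorem re_node_split (z : ℂ) (a : ℝ) :
    ((1 - cexp (-(z * (2 * a : ℝ)))) / z ^ 2).re = (1 / z ^ 2).re - (cexp (-(z * (2 * a : ℝ))) / z ^ 2).re := by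
  rw [sub_div, Complex.sub_re]

/-! ## The exact finite split with the gen11 tail -/

/-- **The finite exponential split, exact main part**: for `a ≥ 0`, every `τ` and every `M`,
`|∫₀^∞ ρ(t) min(t,2a) cos(τt) dt − Σ_{m<M} Re[(1 − e^{−2a(l_m+iτ)})/(l_m+iτ)²]| ≤ 1/L² + 1/(2L)`, `L = 2M + ½`
(the remainder density obeys `rem_M(t) min(t,2a) ≤ t e^{−Lt} + e^{−Lt}/2`, as in `ModulationCostOscillation`). -/
theorem abs_integral_weilArchDensity_mul_min_mul_cos_sub_sum_le (ha : 0 ≤ a) (τ : ℝ) (M : ℕ) :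
    |(∫ t in Ioi (0 : ℝ), weilArchDensity t * min t (2 * a) * Real.cos (τ * t)) -
        ∑ m ∈ Finset.range M, ((1 - cexp (-(((digammaNode m : ℂ) + τ * I) * (2 * a : ℝ)))) /
          ((digammaNode m : ℂ) + τ * I) ^ 2).re| ≤
      1 / (2 * (M : ℝ) + 1 / 2) ^ 2 + 1 / (2 * (2 * (M : ℝ) + 1 / 2)) := by
  have hl : ∀ m : ℕ, (0 : ℝ) < 2 * m + 1 / 2 + ((0 : ℕ) : ℝ) := fun m ↦ by positivity
  set L : ℝ := 2 * M + 1 / 2 with hL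
  have hL0 : 0 < L := by positivity
  have hterm : ∀ m ∈ Finset.range M, IntegrableOn (fun t : ℝ ↦
      Real.exp (-((2 * m + 1 / 2 + ((0 : ℕ) : ℝ)) * t)) * min t (2 * a) * Real.cos (τ * t)) (Ioi 0) :=
    fun m _ ↦ integrableOn_exp_neg_mul_min_mul_cos (hl m) ha τ
  have hS : IntegrableOn (fun t : ℝ ↦ ∑ m ∈ Finset.range M,
      Real.exp (-((2 * m + 1 / 2 + ((0 : ℕ) : ℝ)) * t)) * min t (2 * a) * Real.cos (τ * t)) (Ioi 0) :=
    integrable_finsetSum _ hterm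
  have hR1 := integrableOn_mul_exp_neg_mul_Ioi hL0
  have hR2 := integrableOn_exp_neg_mul_div_two hL0
  have hf := integrableOn_weilArchDensityPar_mul_min_mul_cos 0 ha τ
  have hsplit : ∀ t ∈ Ioi (0 : ℝ), weilArchDensityPar 0 t * min t (2 * a) * Real.cos (τ * t) =
      (∑ m ∈ Finset.range M, Real.exp (-((2 * m + 1 / 2 + ((0 : ℕ) : ℝ)) * t)) * min t (2 * a) * Real.cos (τ * t)) +
        Real.exp (-(((0 : ℕ) : ℝ) * t)) * weilArchDensityRem M t * min t (2 * a) * Real.cos (τ * t) := by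
    intro t ht
    rw [weilArchDensityPar_mul_min_eq_sum_add ht 0 M a, add_mul, Finset.sum_mul]
  have hRint : IntegrableOn (fun t ↦
      Real.exp (-(((0 : ℕ) : ℝ) * t)) * weilArchDensityRem M t * min t (2 * a) * Real.cos (τ * t)) (Ioi 0) := by
    refine (hf.sub hS).congr_fun (fun t ht ↦ ?_) measurableSet_Ioi
    simp only [Pi.sub_apply]
    rw [hsplit t ht]
    ring
  have hI : ∫ t in Ioi (0 : ℝ), weilArchDensityPar 0 t * min t (2 * a) * Real.cos (τ * t) =
      (∑ m ∈ Finset.range M, ∫ t in Ioi (0 : ℝ),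
          Real.exp (-((2 * m + 1 / 2 + ((0 : ℕ) : ℝ)) * t)) * min t (2 * a) * Real.cos (τ * t)) +
        ∫ t in Ioi (0 : ℝ), Real.exp (-(((0 : ℕ) : ℝ) * t)) * weilArchDensityRem M t * min t (2 * a) *
          Real.cos (τ * t) := by
    rw [setIntegral_congr_fun measurableSet_Ioi hsplit, integral_add hS hRint, integral_finsetSum _ hterm]
  -- the node integrals in closed form
  have hnodes : ∑ m ∈ Finset.range M, ∫ t in Ioi (0 : ℝ),
      Real.exp (-((2 * m + 1 / 2 + ((0 : ℕ) : ℝ)) * t)) * min t (2 * a) * Real.cos (τ * t) =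
      ∑ m ∈ Finset.range M, ((1 - cexp (-(((digammaNode m : ℂ) + τ * I) * (2 * a : ℝ)))) /
          ((digammaNode m : ℂ) + τ * I) ^ 2).re := by
    refine Finset.sum_congr rfl fun m _ ↦ ?_
    have e : (2 * (m : ℝ) + 1 / 2 + ((0 : ℕ) : ℝ)) = digammaNode m := by
      rw [digammaNode]; push_cast; ring
    simp only [e]
    exact integral_exp_neg_mul_min_mul_cos (digammaNode_pos m) ha τ
  -- the remainder integral
  have hRbound : |∫ t in Ioi (0 : ℝ),
      Real.exp (-(((0 : ℕ) : ℝ) * t)) * weilArchDensityRem M t * min t (2 * a) * Real.cos (τ * t)| ≤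
      1 / L ^ 2 + 1 / (2 * L) := by
    rw [← integral_mul_exp_neg_mul_Ioi hL0, ← integral_exp_neg_mul_div_two_Ioi hL0, ← integral_add hR1 hR2]
    refine abs_integral_le_integral_abs.trans ?_
    refine setIntegral_mono_on hRint.abs (hR1.add hR2) measurableSet_Ioi fun t (ht : 0 < t) ↦ ?_
    have h0 : Real.exp (-(((0 : ℕ) : ℝ) * t)) = 1 := by simp
    simp only [h0, one_mul]
    have hrem := weilArchDensityRem_le ht M
    rw [← hL] at hrem
    have hrem0 := weilArchDensityRem_nonneg ht M
    have hm0 : 0 ≤ min t (2 * a) := le_min ht.le (by linarith)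
    have hmt : min t (2 * a) ≤ t := min_le_left _ _
    have hX0 : 0 ≤ weilArchDensityRem M t * min t (2 * a) := mul_nonneg hrem0 hm0
    have key : weilArchDensityRem M t * min t (2 * a) ≤ t * Real.exp (-(L * t)) + Real.exp (-(L * t)) / 2 := by
      calc weilArchDensityRem M t * min t (2 * a)
          ≤ (Real.exp (-(L * t)) * (1 + 1 / (2 * t))) * t :=
            mul_le_mul hrem hmt hm0 (by positivity)
        _ = t * Real.exp (-(L * t)) + Real.exp (-(L * t)) / 2 := by field_simp
    rw [abs_mul, abs_of_nonneg hX0]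
    calc weilArchDensityRem M t * min t (2 * a) * |Real.cos (τ * t)|
        ≤ weilArchDensityRem M t * min t (2 * a) * 1 := mul_le_mul_of_nonneg_left (Real.abs_cos_le_one _) hX0
      _ ≤ _ := by rw [mul_one]; exact key
  have hconv : ∫ t in Ioi (0 : ℝ), weilArchDensity t * min t (2 * a) * Real.cos (τ * t) =
      ∫ t in Ioi (0 : ℝ), weilArchDensityPar 0 t * min t (2 * a) * Real.cos (τ * t) :=
    setIntegral_congr_fun measurableSet_Ioi fun t _ ↦ by rw [weilArchDensityPar_zero_apply]
  rw [hconv, hI, hnodes, add_sub_cancel_left]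
  exact hRbound

/-! ## Passing to the full series: the trigamma form -/

/-- `Σ_m e^{−2al_m} = e^{−a}/(1 − e^{−4a})` (`a > 0`; geometric with ratio `e^{−4a}`), as a `HasSum`. -/
theorem hasSum_exp_neg_two_mul_digammaNode (ha : 0 < a) :
    HasSum (fun k : ℕ ↦ Real.exp (-(2 * a * digammaNode k))) (Real.exp (-a) / (1 - Real.exp (-(4 * a)))) := by
  have hq0 : 0 ≤ Real.exp (-(4 * a)) := (Real.exp_pos _).le
  have hq1 : Real.exp (-(4 * a)) < 1 := Real.exp_lt_one_iff.2 (by linarith)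
  have hterm : ∀ k : ℕ, Real.exp (-(2 * a * digammaNode k)) = Real.exp (-a) * Real.exp (-(4 * a)) ^ k := by
    intro k
    rw [digammaNode, ← Real.exp_nat_mul, ← Real.exp_add]
    congr 1; ring
  simp_rw [hterm, div_eq_mul_inv]
  exact (hasSum_geometric_of_lt_one hq0 hq1).mul_left _

/-- **THE OSCILLATORY INCREMENT IN TRIGAMMA FORM** (`a > 0`, every `τ`):
`|∫₀^∞ ρ(t) min(t,2a) cos(τt) dt| ≤ |Re ψ′(¼ + iτ/2)|/4 + E(a)/(¼ + τ²)`, `E(a) = e^{−a}/(1 − e^{−4a})`. -/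
theorem abs_integral_weilArchDensity_mul_min_mul_cos_le_trigamma (ha : 0 < a) (τ : ℝ) :
    |∫ t in Ioi (0 : ℝ), weilArchDensity t * min t (2 * a) * Real.cos (τ * t)| ≤
      |(deriv Complex.digamma (1 / 4 + (τ : ℂ) / 2 * I)).re| / 4 +
        Real.exp (-a) / (1 - Real.exp (-(4 * a))) / (1 / 4 + τ ^ 2) := by
  set Osc := ∫ t in Ioi (0 : ℝ), weilArchDensity t * min t (2 * a) * Real.cos (τ * t) with hOsc
  set E := Real.exp (-a) / (1 - Real.exp (-(4 * a))) with hE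
  have hne : ∀ m : ℕ, digammaNode m ^ 2 + τ ^ 2 ≠ 0 := fun m ↦ by
    have := digammaNode_pos m; positivity
  have hA : HasSum (fun m : ℕ ↦ (1 / ((digammaNode m : ℂ) + τ * I) ^ 2).re)
      ((deriv Complex.digamma (1 / 4 + (τ : ℂ) / 2 * I)).re / 4) := by
    have h := (hasSum_re_deriv_digamma_quarter τ).div_const 4
    refine h.congr_fun fun m ↦ ?_
    show (1 / ((digammaNode m : ℂ) + τ * I) ^ 2).re = 4 * (digammaNode m ^ 2 - τ ^ 2) / (digammaNode m ^ 2 + τ ^ 2) ^ 2 / 4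
    rw [re_one_div_sq_node]
    ring
  have hB : HasSum (fun m : ℕ ↦ Real.exp (-(2 * a * digammaNode m)) / (1 / 4 + τ ^ 2)) (E / (1 / 4 + τ ^ 2)) :=
    (hasSum_exp_neg_two_mul_digammaNode ha).div_const _
  -- termwise: `|Re[e^{−2az}/z²]| ≤ e^{−2al}/(¼ + τ²)`
  have hBle : ∀ m : ℕ, |(cexp (-(((digammaNode m : ℂ) + τ * I) * (2 * a : ℝ))) /
      ((digammaNode m : ℂ) + τ * I) ^ 2).re| ≤ Real.exp (-(2 * a * digammaNode m)) / (1 / 4 + τ ^ 2) := by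
    intro m
    refine (Complex.abs_re_le_norm _).trans ?_
    rw [norm_cexp_neg_div_sq_node]
    apply div_le_div_of_nonneg_left (Real.exp_pos _).le (by positivity)
    have h1 : (1 / 2 : ℝ) ≤ digammaNode m := by
      rw [digammaNode]; have := m.cast_nonneg (α := ℝ); linarith
    nlinarith
  -- for every `M`
  have hM : ∀ M : ℕ, |Osc| ≤ |∑ m ∈ Finset.range M, (1 / ((digammaNode m : ℂ) + τ * I) ^ 2).re| +
      ∑ m ∈ Finset.range M, Real.exp (-(2 * a * digammaNode m)) / (1 / 4 + τ ^ 2) + 5 / ((M : ℝ) + 1) := by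
    intro M
    have h := abs_integral_weilArchDensity_mul_min_mul_cos_sub_sum_le ha.le τ M
    set SA := ∑ m ∈ Finset.range M, (1 / ((digammaNode m : ℂ) + τ * I) ^ 2).re with hSA
    set SB := ∑ m ∈ Finset.range M, (cexp (-(((digammaNode m : ℂ) + τ * I) * (2 * a : ℝ))) /
        ((digammaNode m : ℂ) + τ * I) ^ 2).re with hSB
    have hsplit : ∑ m ∈ Finset.range M, ((1 - cexp (-(((digammaNode m : ℂ) + τ * I) * (2 * a : ℝ)))) /
        ((digammaNode m : ℂ) + τ * I) ^ 2).re = SA - SB := by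
      rw [hSA, hSB, ← Finset.sum_sub_distrib]
      exact Finset.sum_congr rfl fun m _ ↦ re_node_split _ _
    rw [hsplit] at h
    have hB' : |SB| ≤ ∑ m ∈ Finset.range M, Real.exp (-(2 * a * digammaNode m)) / (1 / 4 + τ ^ 2) :=
      (Finset.abs_sum_le_sum_abs _ _).trans (Finset.sum_le_sum fun m _ ↦ hBle m)
    have htail : 1 / (2 * (M : ℝ) + 1 / 2) ^ 2 + 1 / (2 * (2 * (M : ℝ) + 1 / 2)) ≤ 5 / ((M : ℝ) + 1) := by
      have hM0 : (0 : ℝ) ≤ M := M.cast_nonneg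
      rw [div_add_div _ _ (by positivity) (by positivity), div_le_div_iff₀ (by positivity) (by positivity)]
      nlinarith [sq_nonneg ((M : ℝ) - 1)]
    -- `|Osc| ≤ |Osc − (SA − SB)| + |SA| + |SB|`
    have e1 : |Osc| ≤ |Osc - (SA - SB)| + |SA - SB| := by
      have := abs_add_le (Osc - (SA - SB)) (SA - SB); rwa [sub_add_cancel] at this
    have e2 : |SA - SB| ≤ |SA| + |SB| := by
      have := abs_add_le SA (-SB); rwa [abs_neg, ← sub_eq_add_neg] at this
    linarith
  -- the limit `M → ∞`
  have hlim : Tendsto (fun M : ℕ ↦ |∑ m ∈ Finset.range M, (1 / ((digammaNode m : ℂ) + τ * I) ^ 2).re| +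
      ∑ m ∈ Finset.range M, Real.exp (-(2 * a * digammaNode m)) / (1 / 4 + τ ^ 2) + 5 / ((M : ℝ) + 1))
      atTop (𝓝 (|(deriv Complex.digamma (1 / 4 + (τ : ℂ) / 2 * I)).re / 4| + E / (1 / 4 + τ ^ 2) + 0)) := by
    refine ((hA.tendsto_sum_nat.abs).add hB.tendsto_sum_nat).add ?_
    have h5 : Tendsto (fun M : ℕ ↦ (5 : ℝ) * (1 / ((M : ℝ) + 1))) atTop (𝓝 (5 * 0)) :=
      tendsto_one_div_add_atTop_nhds_zero_nat.const_mul 5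
    rw [mul_zero] at h5
    exact h5.congr fun M ↦ by ring
  have hfin := ge_of_tendsto' hlim hM
  rw [add_zero, abs_div, abs_of_pos (by norm_num : (0 : ℝ) < 4)] at hfin
  exact hfin

/-! ## Stirling: `Re ψ′(¼ + iτ/2) = O(1/τ²)` -/

/-- **Second-order bound for `Re ψ′` on the quarter line**: for `|τ| ≥ 2`,
`|Re ψ′(¼ + iτ/2)| ≤ 3/τ² + 11.53/|τ|³`
(`ψ′(w) = 1/w + 1/(2w²) + 1/(6w³) + R`, `‖R‖ ≤ 4/(π|w|³)`, `Re(1/w) = ¼/|w|²`, `|w| ≥ |τ|/2`). -/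
theorem abs_re_deriv_digamma_quarter_le_second {τ : ℝ} (hτ : 2 ≤ |τ|) :
    |(deriv Complex.digamma (1 / 4 + (τ : ℂ) / 2 * I)).re| ≤ 3 / τ ^ 2 + 11.53 / |τ| ^ 3 := by
  set w : ℂ := 1 / 4 + (τ : ℂ) / 2 * I with hw
  have hre : w.re = 1 / 4 := by simp [hw]
  have him : w.im = τ / 2 := by simp [hw]
  have hre0 : 0 < w.re := by rw [hre]; norm_num
  have hτ0 : 0 < |τ| := by linarith
  have hπ := Real.pi_pos
  have hπ3 := Real.pi_gt_d6
  have hnsq : ‖w‖ ^ 2 = 1 / 16 + τ ^ 2 / 4 := by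
    rw [Complex.sq_norm, Complex.normSq_apply, hre, him]; ring
  have hn1 : |τ| / 2 ≤ ‖w‖ := by
    refine (pow_le_pow_iff_left₀ (by positivity) (norm_nonneg _) two_ne_zero).1 ?_
    rw [hnsq, div_pow, sq_abs]; nlinarith [sq_nonneg τ]
  have hn0 : 0 < ‖w‖ := lt_of_lt_of_le (by positivity) hn1
  have hw0 : w ≠ 0 := norm_pos_iff.1 hn0
  -- Stirling's series of order 1 for `ψ′`
  have hS := Literature.Analysis.SpecialFunctions.Complex.norm_deriv_digamma_sub_stirlingSeries_le hre0
    (ν := 1) one_ne_zero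
  simp only [Finset.Icc_self, Finset.sum_singleton, Nat.mul_one] at hS
  have hC : (2 * (1 : ℕ) + 2 : ℝ) * (Real.pi ^ 2 / 3 * ((2 * 1 + 1).factorial : ℝ) / (2 * Real.pi) ^ (2 * 1 + 1)) /
      (‖w‖ ^ (2 * 1 + 1) * w.re) = 4 / (Real.pi * ‖w‖ ^ 3) := by
    rw [hre]
    norm_num [Nat.factorial]; field_simp; ring
  have hS' : ‖deriv Complex.digamma w - (1 / w + 1 / (2 * w ^ 2) + (bernoulli (2 * 1) : ℂ) / w ^ (2 * 1 + 1))‖ ≤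
      4 / (Real.pi * ‖w‖ ^ 3) := by
    have := hS; push_cast at this hC ⊢; rw [hC] at this; exact this
  -- the main terms
  have hB2 : (bernoulli (2 * 1) : ℂ) = (1 / 6 : ℂ) := by
    rw [Nat.mul_one, bernoulli_two]; push_cast; norm_num
  have h1 : (1 / w).re = 1 / 4 / ‖w‖ ^ 2 := by
    rw [one_div, Complex.inv_re, hre, Complex.normSq_eq_norm_sq]
  have h2 : |(1 / (2 * w ^ 2)).re| ≤ 1 / (2 * ‖w‖ ^ 2) := by
    refine (Complex.abs_re_le_norm _).trans (le_of_eq ?_)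
    rw [norm_div, norm_one, norm_mul, norm_pow, Complex.norm_two]
  have h3 : |((bernoulli (2 * 1) : ℂ) / w ^ (2 * 1 + 1)).re| ≤ 1 / 6 / ‖w‖ ^ 3 := by
    rw [hB2]
    refine (Complex.abs_re_le_norm _).trans (le_of_eq ?_)
    rw [norm_div, norm_pow]
    norm_num
  have hmain : |(1 / w + 1 / (2 * w ^ 2) + (bernoulli (2 * 1) : ℂ) / w ^ (2 * 1 + 1)).re| ≤
      1 / 4 / ‖w‖ ^ 2 + 1 / (2 * ‖w‖ ^ 2) + 1 / 6 / ‖w‖ ^ 3 := by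
    rw [Complex.add_re, Complex.add_re, h1]
    have e := abs_add_le (1 / 4 / ‖w‖ ^ 2 + (1 / (2 * w ^ 2)).re) (((bernoulli (2 * 1) : ℂ) / w ^ (2 * 1 + 1)).re)
    have e' := abs_add_le (1 / 4 / ‖w‖ ^ 2) ((1 / (2 * w ^ 2)).re)
    rw [abs_of_pos (div_pos (by norm_num) (pow_pos hn0 2) : (0 : ℝ) < 1 / 4 / ‖w‖ ^ 2)] at e'
    linarith
  -- `|Re ψ′| ≤ ‖ψ′ − main‖ + |Re main|`
  have hsplit : |(deriv Complex.digamma w).re| ≤ 4 / (Real.pi * ‖w‖ ^ 3) +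
      (1 / 4 / ‖w‖ ^ 2 + 1 / (2 * ‖w‖ ^ 2) + 1 / 6 / ‖w‖ ^ 3) := by
    have e : (deriv Complex.digamma w).re =
        (deriv Complex.digamma w - (1 / w + 1 / (2 * w ^ 2) + (bernoulli (2 * 1) : ℂ) / w ^ (2 * 1 + 1))).re +
          (1 / w + 1 / (2 * w ^ 2) + (bernoulli (2 * 1) : ℂ) / w ^ (2 * 1 + 1)).re := by
      rw [← Complex.add_re, sub_add_cancel]
    rw [e]
    refine (abs_add_le _ _).trans (add_le_add ((Complex.abs_re_le_norm _).trans hS') hmain)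
  -- numerics: `1/‖w‖² ≤ 4/τ²`, `1/‖w‖³ ≤ 8/|τ|³`, `4/π ≤ 1.2733`
  have hτ2 : 0 < τ ^ 2 := by rw [← sq_abs]; exact pow_pos hτ0 2
  have i2 : 1 / ‖w‖ ^ 2 ≤ 4 / τ ^ 2 := by
    rw [div_le_div_iff₀ (pow_pos hn0 2) hτ2, hnsq]; nlinarith [sq_nonneg τ]
  have i3 : 1 / ‖w‖ ^ 3 ≤ 8 / |τ| ^ 3 := by
    have h := pow_le_pow_left₀ (by positivity) hn1 3
    rw [div_pow] at h
    rw [div_le_div_iff₀ (pow_pos hn0 3) (pow_pos hτ0 3)]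
    norm_num at h ⊢; linarith
  have i4 : 4 / (Real.pi * ‖w‖ ^ 3) ≤ 1.2733 * (1 / ‖w‖ ^ 3) := by
    have hx : 4 / (Real.pi * ‖w‖ ^ 3) = 4 / Real.pi * (1 / ‖w‖ ^ 3) := by
      rw [← div_div, div_eq_mul_one_div]
    have hpi : 4 / Real.pi ≤ 1.2733 := by
      rw [div_le_iff₀ Real.pi_pos]; nlinarith
    have hw3 : 0 ≤ 1 / ‖w‖ ^ 3 := by positivity
    rw [hx]; exact mul_le_mul_of_nonneg_right hpi hw3
  have e2 : 1 / 4 / ‖w‖ ^ 2 + 1 / (2 * ‖w‖ ^ 2) = 3 / 4 * (1 / ‖w‖ ^ 2) := by ring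
  have e3 : 1 / 6 / ‖w‖ ^ 3 = 1 / 6 * (1 / ‖w‖ ^ 3) := by ring
  rw [e2, e3] at hsplit
  have s2 : 3 / 4 * (1 / ‖w‖ ^ 2) ≤ 3 / 4 * (4 / τ ^ 2) := mul_le_mul_of_nonneg_left i2 (by norm_num)
  have s3 : (1.2733 + 1 / 6) * (1 / ‖w‖ ^ 3) ≤ (1.2733 + 1 / 6) * (8 / |τ| ^ 3) :=
    mul_le_mul_of_nonneg_left i3 (by norm_num)
  have s4 : (1.2733 + 1 / 6) * (8 / |τ| ^ 3) ≤ 11.53 / |τ| ^ 3 := by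
    rw [show (1.2733 + 1 / 6 : ℝ) * (8 / |τ| ^ 3) = ((1.2733 + 1 / 6) * 8) * (1 / |τ| ^ 3) by ring,
      show (11.53 : ℝ) / |τ| ^ 3 = 11.53 * (1 / |τ| ^ 3) by ring]
    exact mul_le_mul_of_nonneg_right (by norm_num) (by positivity)
  have s5 : 3 / 4 * (4 / τ ^ 2) = 3 / τ ^ 2 := by ring
  linarith

/-- **THE OSCILLATORY ARCHIMEDEAN INCREMENT TO SECOND ORDER** (`a > 0`, `|τ| ≥ 2`):
`|∫₀^∞ ρ(t) min(t,2a) cos(τt) dt| ≤ 0.75/τ² + 2.89/|τ|³ + E(a)/(¼ + τ²)`, `E(a) = e^{−a}/(1 − e^{−4a})`. -/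
theorem abs_integral_weilArchDensity_mul_min_mul_cos_le_second (ha : 0 < a) {τ : ℝ} (hτ : 2 ≤ |τ|) :
    |∫ t in Ioi (0 : ℝ), weilArchDensity t * min t (2 * a) * Real.cos (τ * t)| ≤
      0.75 / τ ^ 2 + 2.89 / |τ| ^ 3 + Real.exp (-a) / (1 - Real.exp (-(4 * a))) / (1 / 4 + τ ^ 2) := by
  have h := abs_integral_weilArchDensity_mul_min_mul_cos_le_trigamma ha τ
  have h2 := abs_re_deriv_digamma_quarter_le_second hτ
  have hτ0 : 0 < |τ| := by linarith
  have h3 : |(deriv Complex.digamma (1 / 4 + (τ : ℂ) / 2 * I)).re| / 4 ≤ 0.75 / τ ^ 2 + 2.89 / |τ| ^ 3 := by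
    rw [div_le_iff₀ (by norm_num : (0 : ℝ) < 4)]
    refine h2.trans ?_
    have : 0 ≤ 1 / |τ| ^ 3 := by positivity
    rw [show 11.53 / |τ| ^ 3 = 11.53 * (1 / |τ| ^ 3) by ring,
      show (0.75 / τ ^ 2 + 2.89 / |τ| ^ 3) * 4 = 3 / τ ^ 2 + 11.56 * (1 / |τ| ^ 3) by ring]
    nlinarith
  linarith

end Summit.Ventures.WeilGRH

end
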